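import Mathlib
import HarnessLib
import HarnessLib.Audit
import Summits.SmoothPoincare4.Statement
import Literature.Topology.FourManifolds.HomotopySpheres
import Literature.Topology.FourManifolds.GluckTwist
import Literature.Topology.FourManifolds.SmoothOrientation
import Literature.Geometry.Lorentzian.PseudoRiemannianMetric
import Literature.Topology.FourManifolds.Knots
import Literature.Geometry.Lorentzian.LeviCivita
import Literature.Geometry.Riemannian.IsotropicCurvature
import Literature.Geometry.Riemannian.ConformallyFlat
import Literature.Geometry.Riemannian.KuiperDevelopment
import Literature.Topology.FourManifolds.HomotopyS4CompactProofs
import Literature.Topology.FourManifolds.HomotopyS4OrientableProofs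
import Literature.Topology.FourManifolds.SphereSimplyConnected
import Literature.Geometry.Riemannian.WeylEnergy
import Summits.SmoothPoincare4.SmoothPoincare4.Theorems.PICAssembly
import Summits.SmoothPoincare4.SmoothPoincare4.Theorems.SullivanDualSpc4ReductionHomotopySphere

/-!
Route: PIC

DORMANT since 2026-09-04T19:06:32Z (reconciler: no traction for 5 d (last activity statement-checked at 2026-08-30T18:09:06Z); parked, not closed — `ledger route dormant route-SmoothPoincare4-PIC --off` to reactivate) — unstaffed, not closed; items shared with open routes are served there. `ledger route dormant <id> --off` reactivates.

# Route PIC — every smooth homotopy 4-sphere carries a metric of positive isotropic curvature (PIC)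

It suffices to show X = PicThesisV2: every homotopy 4-sphere Σ
(`Literature.Topology.FourManifolds.HomotopySphere 4`) carries a C^∞
Riemannian metric of positive isotropic curvature (PIC: for every Levi-Civita connection and every
orthonormal 4-frame
K₁₃+K₁₄+K₂₃+K₂₄ − 2R₁₂₃₄ > 0; MicallefMoore1988 §1, `HasPositiveIsotropicCurvature`). X ⇔ SPC4
modulo the published Hamilton–Chen–Tang–Zhu
theorem (Hamilton1997 Cor. 1.2(a), ChenZhu2006, ChenTangZhu2012 = Literature named fact
hamilton_pic_sphere_four, UNPROVED in tree): SPC4 ⇒ X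
by the round metric; X ∧ HCTZ ⇒ SPC4 by the route's PIC-branch glue Assembly2 (PROVED in Theorems as
Literature.SPC4.pic_assembly) and the
reduction Spc4ReductionHomotopySphereV2 (PROVED as
Literature.SPC4.smoothPoincare4_of_forall_homotopySphere).
DECIDING THEOREM (rev 3; D-0027): the route has two sufficient cruxes and the deciding theorem is
written through the one whose glue is
UNCONDITIONAL in tree — the flow-free LCF branch: `closes (hL : PicConformallyFlatV2) (hA :
Assembly3) (hR : Spc4ReductionHomotopySphereV2) :
SmoothPoincare4 := hR compact orientable (hA kuiper simplyConnected hL)`, where kuiper =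
kuiper_conformallyFlat_sphere_four_holds (Kuiper1949,
PROVED in tree), compact / orientable / simplyConnected =
compactSpace_of_homotopyEquiv_sphere_four_holds, isOrientable_of_homotopyEquiv_sphere_four_holds,
simplyConnectedSpace_sphere_four_holds (all PROVED), and Assembly3 / Spc4ReductionHomotopySphereV2
are this route's bookkeeping items, themselves
proved in Theorems (Literature.SPC4.lcf_assembly, smoothPoincare4_of_forall_homotopySphere). So the
route decides SPC4 with NO literature debt via
PicConformallyFlatV2 (rank 4: every Σ carries a locally conformally flat metric), and modulo one
theorem in print via the thesis X (the
PIC-branch deciding theorem closes (hX : PicThesisV2) (hH : HamiltonChenTangZhu) … is lean-checked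
in the planner folder, audit OK, but its fact
item cannot be filed today — see NOT DECOMPOSED YET). LCF ⇒ SPC4 ⇒ PIC: the two sufficient
statements are equivalent to each other and to SPC4
modulo HCTZ; X (PIC, an OPEN curvature condition with room for gluing / conformal deformation /
flows) stays the construction target and
PicConformallyFlatV2 (a flat conformal structure, no slack) the certificate with the debt-free glue.
Ranked rungs: PicGluckV2 (test family: PIC on every Gluck twist Σ_K), PicPscV2 (necessary floor: PSC
on every Σ), WeylEnergyPinching
(scal > 0 and ∫|W|² < 32π²; decides modulo ChangGurskyYang2003 Thm A = Literature fact
changGurskyYang_sphere_four; typed over `g.weylEnergy`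
in the planner folder, lands with the reroute), PicConformallyFlatV2 (LCF).
PENDING REROUTE (prepared, schema-clean and lean-checked in the repair planner's folder: Route.md /
edit.json / glue.lean / Sketch.lean,
2026-08-15): restate every item over the summit binder ∀ M …, M ≃ₕ S⁴ → … (PicMetric;
PscOnHomotopySpheres = BachCriticalElement's
stmt-SmoothPoincare4-4395; WeylEnergyPinching typed; LcfMetric; LcfSpheresStandard;
HamiltonChenTangZhu = IsotropicCorkBracketing's
stmt-SmoothPoincare4-9824; ChangGurskyYangSphereFour), drop the 8 duplicate / HomotopySphere-form
items (0374 0380 0382 0383 0384 0441 0442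
0475) and the GluckTwist / Knots / HomotopySpheres / SmoothOrientation imports, one assembly —
blocked today: the gate neither drops nor
re-badges assembly-kind items, yet bounces every add / drop / restate while three exist (operator:
close stmt-SmoothPoincare4-0474 / 0477 as
proved by the Theorems above, or re-badge them support; then the folder's edit.json applies
verbatim).
Lean: `∀ S : Literature.Topology.FourManifolds.HomotopySphere 4, ∃ g :
Literature.Geometry.Lorentzian.PseudoRiemannianMetric (𝓡 4) ∞ (EuclideanSpace ℝ (Fin 4))
(TangentSpace (𝓡 4) : S.carrier → Type _), g.IsRiemannian ∧ g.HasPositiveIsotropicCurvature`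

Rationale: WHY THIS LINE. The only dimension in which a smooth Poincaré conjecture was PROVED by constructing
the diffeomorphism is 3, by Ricci flow
(Perelman); in dimension 4 Hamilton's flow with surgery exists exactly under PIC and, for π₁ = 1,
outputs S⁴ (Hamilton1997 Thm 1.1 /
Cor. 1.2(a); surgery completed in ChenZhu2006; ChenTangZhu2012), so SPC4 is EQUIVALENT to a pure
existence-of-metric statement and the
problem moves to geometric analysis / nonlinear PDE (curvature deformation, conformal methods with
W-control, gluing, min-max). "Admits PIC"
is sensitive to the smooth structure (standard RP⁴ is PIC, the fake one is not: Hamilton1997 p. 3),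
so the invariant is not blind in
Freedman's sense. Weaker and stronger curvature conditions give the informative rungs: PSC on a
GIVEN smooth homotopy 4-sphere is open
(KumarSen2025 Obs. 9: Gromov–Lawson–Stolz holds in dim 4 only up to homeomorphism); integral Weyl
pinching decides via ChangGurskyYang2003
Thm A (fully nonlinear conformal PDE + Margerin1998); local conformal flatness decides via
Kuiper1949 with no flow, and that branch is
debt-free in tree. Imported area: Riemannian geometry / geometric flows (dictionary: exotic
structure ↔ obstruction to a curvature
condition); no spectral, probabilistic or physical reformulation. Sibling routes BachCriticalElement
(Weyl-energy minimisers for the PSC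
floor) and IsotropicCorkBracketing (cork presentations) branch from this existence programme and
share its fact item HamiltonChenTangZhu
(stmt-SmoothPoincare4-9824).
RANKED CRUXES. #0 PicThesisV2 (target) — X (why it might fail: ⇔ SPC4 mod HCTZ, no mechanism yields
PIC on a 4-manifold not already
identified with S⁴; Hamilton1997, Hoelzel2016). #2 PicGluckV2 — PIC on every Gluck twist Σ_K, the
test family (why: needs PIC across the codim-2 neck S²×S¹×I, outside Hoelzel2016 Thm A /
MicallefWang1993; one exotic Gluck twist refutes it; Gluck1962). #3 PicPscV2 — PSC on every homotopy
4-sphere, the necessary floor (why: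
open on a GIVEN smooth Σ, KumarSen2025 Obs. 9; all known dim-4 PSC obstructions are silent on Σ). #3
WeylEnergyPinching (stmt-1670,
typed by set-signature right after this edit; statement: ∀ M ≃ₕ S⁴ ∃ g, ∃ _ : g.HasLeviCivita,
g.IsRiemannian ∧ (∀ x, 0 <
g.scalarCurvature x) ∧ g.weylEnergy < ENNReal.ofReal (32 * Real.pi ^ 2)) (why: ⇔ SPC4 mod CGY;
Weyl-minimising sequences bubble;
ChangGurskyYang2003, ChangChen2021). #4 PicConformallyFlatV2 — LCF metric on every Σ; the crux the
DECIDING THEOREM rests on, its glue being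
debt-free (why: ⇔ SPC4 with no slack, W = 0 overdetermined, no existence theory short of a
diffeomorphism; Kuiper1949, SchoenYau1988).
needs-fact (PIC branch, not fileable as an item today):
Literature.Geometry.Riemannian.hamilton_pic_sphere_four = IsotropicCorkBracketing's
item stmt-SmoothPoincare4-9824 (why it is only debt: published theorem, Hamilton1997 / ChenZhu2006 /
ChenTangZhu2012; vendoring fidelity —
PIC quantifies over Levi-Civita connections whose existence isLeviCivita_leviCivita is itself a
named fact — is the one risk). Assemblies: Assembly2 (PIC branch, proved as
Literature.SPC4.pic_assembly), Assembly3 (LCF branch, proved as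
Literature.SPC4.lcf_assembly), Assembly (stmt-0381, informal-era duplicate of Assembly2) — three
only because the gate lets a planner
neither drop nor re-badge assembly items; support Spc4ReductionHomotopySphereV2 (proved as
Literature.SPC4.smoothPoincare4_of_forall_homotopySphere),
Spc4ReductionHomotopySphere / PicThesis / PicGluckTwists / PicPsc / PicConformallyFlat (superseded
duplicates, to be dropped).
KILL CRITERIA. PicPscV2 refuted (a smooth homotopy 4-sphere without PSC) ⇒ that Σ is exotic, SPC4 is
refuted and the route closes with the
problem; likewise ¬PicThesisV2, ¬WeylEnergyPinching, ¬PicConformallyFlatV2 (each ⇔ SPC4 modulo a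
theorem). PicGluckV2 refuted ⇒ an exotic
Gluck twist ⇒ ¬SPC4 as well. HamiltonChenTangZhu "refuted" could only be a VENDORING defect (vacuous
PIC because no Levi-Civita connection
exists in the tree's encoding): pivot = restate X and the fact over an explicit Levi-Civita witness,
not a mathematical kill. A theorem
"PIC metrics on homotopy 4-spheres are isotopic to round" adds nothing and is NOT a kill. SPC4
proved elsewhere moots the route.
NOT DECOMPOSED YET. (i) HOW to build PIC metrics (gluing along the Kervaire–Milnor h-cobordism,
conformal deformation from PSC with
W⁺-control, PIC interpolation across codimension-2 necks) — below crux level. (ii) The summit-binder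
REROUTE itself (folder edit.json):
PicMetric / PscOnHomotopySpheres (= stmt-SmoothPoincare4-4395) / WeylEnergyPinching typed /
LcfMetric / LcfSpheresStandard (Kuiper for
homotopy spheres, provable now) / ChangGurskyYangSphereFour (verbatim changGurskyYang_sphere_four),
one assembly, imports LeviCivita +
IsotropicCurvature + ConformallyFlat + WeylEnergy + HomotopyS4CompactProofs + SphereSimplyConnected
only, closes (hX : PicMetric)
(hH : HamiltonChenTangZhu) — waits for the operator to free the two extra assembly items; until then
the deciding theorem is the LCF-branch
one over the rev-2 items. (iii) PIC ⇒ PSC as a formal lemma (needs first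
Bianchi curvature_cyclic_sum_eq_zero and Levi-Civita existence, both named facts). (iv)
Finite-extinction / Yamabe-invariant
reformulations — not known to imply diffeomorphism. needs-fact:
Literature.Geometry.Riemannian.hamilton_pic_sphere_four (deciding theorem);
needs-fact: Literature.Geometry.Riemannian.changGurskyYang_sphere_four (Weyl branch only).
CHEAPEST FALSIFIER. Lookup: is there a smooth homotopy 4-sphere presentation (undecided
Cappell–Shaneson matrix, non-ribbon Gluck twist) on
which ANY PSC obstruction is even defined? All known dim-4 PSC obstructions (Seiberg–Witten needs
b₂⁺ ≥ 1; Â = −σ/8; enlargeability) are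
silent on Σ (b₂ = 0, σ = 0, π₁ = 1) — checked against KumarSen2025 and the barrier files
GaugeSumBarrierFour / TopologicalBarrierFour:
nothing applies, so the line is not cheaply killable. Cheapest positive sanity check, done
2026-08-15: both deciding theorems elaborate sorry-free with
the native audit verdict OK (folder SketchCur2.lean = LCF branch, installed; SketchCur.lean = PIC
branch + HCTZ item; #h21_check_closes codes [],
axioms propext/choice/Quot.sound).
NUMBERS. PIC threshold K₁₃+K₁₄+K₂₃+K₂₄ − 2R₁₂₃₄ > 0 per orthonormal 4-frame (round S⁴: ≡ 4). CGY
threshold ∫|W|² dV < 16π²χ(Σ) = 32π² with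
the (0,4)-norm (ChangGurskyYang2003 (0.3), Remark 2). Surgery stability: PIC codim ≥ 4, PSC codim ≥
3 (Hoelzel2016 Thm A; MicallefWang1993).
Items: 14 (unchanged by this edit), 10 after the pending reroute.
DEFINITION REQUESTS. None open: defn-HasPositiveIsotropicCurvature, defn-IsLocallyConformallyFlat
and defn-weylEnergy have landed
(IsotropicCurvature.lean, ConformallyFlat.lean, WeylEnergy.lean).

Novelty: NOVELTY (retriage planner, 2026-08-14; searches run before writing: `lit search --hybrid "positive
isotropic curvature homotopy 4-sphere smooth Poincare conjecture exotic"`, `lit search "exotic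
4-sphere positive scalar curvature metric"`, `lit search "Ricci flow surgery positive isotropic
curvature four-manifolds diffeomorphic sphere simply connected"`, `lit search "smooth Poincare
conjecture dimension four Ricci flow approach"`, `lit search --hybrid "Gluck twist ... positive
isotropic curvature surgery codimension two"`, `lit search "conformally flat metric exotic sphere
Kuiper developing map obstruction"`, `lit frontier SmoothPoincare4 --since 2020`, `lit bridges
SmoothPoincare4 --cross any`; `ledger negatives --problem SmoothPoincare4` = 0 refuted statements.)

Nearest prior art actually found:
1. Hamilton1997 (doi:10.4310/CAG.1997.v5.n1.a1), p.3, right after Cor. 1.2(a): "In four dimensions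
it is an open question to date whether there are any exotic differentiable structures on S4.
Therefore 1.2(a) is possibly an improvement on the result of Micallef and Moore ... The standard RP4
admits a metric of positive isotropic curvature, but the fake one does not. Hence this curvature
pinching hypothesis is sensitive to the differentiable structure." So the equivalence thesis X <=>
SPC4 (mod Cor. 1.2(a), completed by ChenZhu2006 Thm 1.1 / ChenTangZhu2012 = arXiv:0810.1999 'Theorem
(Hamilton)') is IMPLICIT in Hamilton 1997; the route does not claim the reformulation as new.
2. Othe  [refs: 10.4310/CAG.1997.v5.n1.a1, 10.4310/cag.1998.v6.n1.a2, 0810.1999, 2501.01113, 1303.6531, 2102.12615, doi:10.4310/CAG.1997.v5.n1.a1, doi:10.4310/cag.1998.v6.n1.a2, Hamilton1997, ChenZhu2006, ChenTangZhu2012, Margerin1998, BrendleSchoen2009, KumarSen2025, Hoelzel2016, MicallefWang1993]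

Barriers (technique_class: curvature existence, PIC/LCF metrics; Ricci flow with surgery): BARRIERS (catalogue Literature/Barriers/SmoothPoincare4/*, all 22 files read 2026-08-14; `ledger
negatives --problem SmoothPoincare4` = 0 refuted statements). One line per catalogued barrier decl;
"positive side" = this route proves Sigma = S^4 via a metric, "negative side" = its kill criteria (a
homotopy 4-sphere / Gluck twist WITHOUT a PSC or PIC metric would be exotic).

- Literature.Barriers.SmoothPoincare4.HCobordismBarrierFour (h-cobordism => diffeo fails, Donaldson
1987): EVADED as diffeomorphism engine — the route never invokes the h-cobordism principle; the
diffeomorphism comes from the surgically modified Ricci flow (named fact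
Literature.Geometry.Riemannian.hamilton_pic_sphere_four, reduced in tree to
hamilton_pic_neckSurgery_resolvable_four) or, on the LCF branch, from Kuiper's development (PROVED
in tree: kuiper_conformallyFlat_sphere_four_holds). NOT evaded for metric CONSTRUCTION along the
Kervaire–Milnor h-cobordism (Theta_4 = 0,
Literature.Topology.FourManifolds.isHCobordant_sphere_of_homotopySphere_four): its 3-handles are
codimension-2 surgeries and PIC (resp. PSC) is surgery-stable only in codimension >= 4 (resp. >= 3)
[Hoelzel2016 Thm A; MicallefWang1993]; the bet is an analytic existence mechanism (conformal
deformation with W^+-control, or PIC interpolation across the Gluck neck S^2 x S^1 x I) that does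
not factor through handle moves — none is in print.
- Literature.Barriers.SmoothPoincare4.ProjectiveRigidityBarrierFour (fake RP^4 double-covered by S^4

History (route lifecycle, newest last):
- 2026-08-16T02:17:20Z · AUTO-CRUX: 1 conjecture-grade item(s) promoted to crux (PicGluckTwists) — refuter vetting / tiering apply (operator:999:1362873)
- 2026-08-16T14:43:05Z · LINT AUTOFIX route.multi-assembly: kept Assembly3, dropped Assembly, Assembly2 (gate:hygiene)
- 2026-08-23T11:34:36Z · DORMANT — reconciler: no traction for 6.1 d (last activity statement-grounded at 2026-08-17T08:43:30Z); parked, not closed — `ledger route dormant route-SmoothPoincare4-P (operator:999:296422)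
- 2026-08-30T17:13:47Z · REACTIVATED (open) — reconciler: reactivated — activity statement-checked at 2026-08-30T16:13:55Z after parking at 2026-08-23T11:34:36Z (operator:999:674536)
- 2026-09-04T19:06:32Z · DORMANT — reconciler: no traction for 5 d (last activity statement-checked at 2026-08-30T18:09:06Z); parked, not closed — `ledger route dormant route-SmoothPoincare4-PIC (operator:999:2449856)

sub-problem: SmoothPoincare4 · status: dormant · opened planner-SmoothPoincare4-Survey-0 2026-08-13T06:11:41Z · rev 5 · ledger route-SmoothPoincare4-PIC
GENERATED by the gate from the ledger (D-0016/17). Provers cite these decls: `theorem foo : Summit.SmoothPoincare4.SmoothPoincare4.Theses.PIC.<Decl> := …` in Summits/SmoothPoincare4/SmoothPoincare4/Theorems/<Name>.lean.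
-/

namespace Summit.SmoothPoincare4.SmoothPoincare4.Theses.PIC

open scoped BigOperators Topology Manifold Classical MeasureTheory ProbabilityTheory Matrix InnerProductSpace ComplexConjugate ContinuousMap ContDiff
open Filter Set Function TopologicalSpace MeasureTheory

attribute [summit_statement] _root_.SmoothPoincare4

open Literature.SPC4

/-! Retired items kept as plain definitions (history; not obligations of this route): landed proofs / closed glue still name them. -/

-- tombstone: stmt-SmoothPoincare4-0474 was DROPPED from this route but is still named by active items / landed proofs — kept as a plain def (no route_item tag), not an obligation of this route
/-- retired stmt-SmoothPoincare4-0474 (dropped, gen None) — proved by Literature.SPC4.pic_assembly. -/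
def Assembly2 : Prop :=
  (∀ (M : Type) [TopologicalSpace M] [T2Space M] [SecondCountableTopology M] [ChartedSpace (EuclideanSpace ℝ (Fin 4)) M] [IsManifold (𝓡 4) ∞ M] [CompactSpace M] [SimplyConnectedSpace M], (∃ g : Literature.Geometry.Lorentzian.PseudoRiemannianMetric (𝓡 4) ∞ (EuclideanSpace ℝ (Fin 4)) (TangentSpace (𝓡 4) : M → Type _), g.IsRiemannian ∧ g.HasPositiveIsotropicCurvature) → Nonempty (M ≃ₘ⟮𝓡 4, 𝓡 4⟯ Metric.sphere (0 : EuclideanSpace ℝ (Fin 5)) 1)) → (∀ (M : Type) [TopologicalSpace M], M ≃ₕ Metric.sphere (0 : EuclideanSpace ℝ (Fin 5)) 1 → SimplyConnectedSpace M) → (∀ S : Literature.Topology.FourManifolds.HomotopySphere 4, ∃ g : Literature.Geometry.Lorentzian.PseudoRiemannianMetric (𝓡 4) ∞ (EuclideanSpace ℝ (Fin 4)) (TangentSpace (𝓡 4) : S.carrier → Type _), g.IsRiemannian ∧ g.HasPositiveIsotropicCurvature) → ∀ S : Literature.Topology.FourManifolds.HomotopySphere 4, Nonempty (S.carrier ≃ₘ⟮𝓡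 4, 𝓡 4⟯ Metric.sphere (0 : EuclideanSpace ℝ (Fin 5)) 1)

/-- item stmt-SmoothPoincare4-0473 · target · rank 0 · open · by planner
why it might fail: X <=> SPC4 mod hamilton_pic_sphere_four, so X is false iff an exotic S^4 exists; as a programme it can stall: no mechanism yields PIC on a 4-manifold not already identified with S^4 (PIC is surgery-stable only in codim >= 4, i.e. connected sums), and Bamler judges 4-d flows unlikely to reach SPC4.
sources: Hamilton1997, ChenTangZhu2012, Hoelzel2016, MicallefWang1993, Bamler2021Notices, Literature.Geometry.Riemannian.hamilton_pic_sphere_four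
SUPERSEDES the informal stmt-SmoothPoincare4-0380: defn-HasPositiveIsotropicCurvature is DONE
(IsotropicCurvature.lean:211, `g.HasPositiveIsotropicCurvature := ∀ cov, g.IsLeviCivita cov → ∀ x, ∀
g-orthonormal 4-frame e, 0 < K₁₃+K₁₄+K₂₃+K₂₄ − 2R₁₂₃₄`; MicallefMoore1988 §1). Content unchanged: ∀
Σ : Literature.Topology.FourManifolds.HomotopySphere 4, ∃ g on TΣ, g.IsRiemannian ∧
g.HasPositiveIsotropicCurvature. OPEN; SPC4 ⇒ this (round S⁴ has K ≡ 1, isotropic curvature ≡ 4);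
with the HCTZ fact (cite item fact_hctz_v2) this ⇒ SPC4, so thesis ⇔ SPC4 modulo a theorem. Stronger
than the PSC crux 0442 (PIC ⇒ scal > 0). No `∃ _ : g.HasLeviCivita` binder is needed here (the def
quantifies over Levi-Civita connections itself). Sources: MicallefMoore1988 §1; Hamilton1997 Thm
1.1; ChenTangZhu2012 Thm 1.1. opens: `open scoped Manifold ContDiff`, `open ContinuousMap`; imports:
Summits.SmoothPoincare4.Statement +
Literature.Topology.FourManifolds.{HomotopySpheres,GluckTwist,CorkTwist,Corks} +
Literature.Geometry.Riemannian.{IsotropicCurvature,ConformallyFlat} +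
Literature.Geometry.Lorentzian.LeviCivita. Elaborated 2026-08-13 session 5 with plain `lean check`
(planner folder Sk/Sketch5.lean rc 0, 1 -/
@[route_item "route-SmoothPoincare4-PIC"]
def PicThesisV2 : Prop :=
  ∀ S : Literature.Topology.FourManifolds.HomotopySphere 4, ∃ g : Literature.Geometry.Lorentzian.PseudoRiemannianMetric (𝓡 4) ∞ (EuclideanSpace ℝ (Fin 4)) (TangentSpace (𝓡 4) : S.carrier → Type _), g.IsRiemannian ∧ g.HasPositiveIsotropicCurvature

/-- item stmt-SmoothPoincare4-0476 · crux · rank 4 · open · by planner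
why it might fail: LCF + compact + pi_1 = 1 forces M = S^4 (Kuiper, proved in tree: kuiper_conformallyFlat_sphere_four_holds), so this <=> SPC4 with no slack: an LCF metric on Sigma is a developed round structure, W(g) = 0 is overdetermined with no existence theory; no construction short of a diffeomorphism is known.
sources: Kuiper1949, Besse1987, SchoenYau1988, arXiv:1301.6525, ChenTangZhu2012, Literature.Geometry.Riemannian.kuiper_conformallyFlat_sphere_four_holds
SUPERSEDES the informal stmt-SmoothPoincare4-0384: defn-IsLocallyConformallyFlat is DONE
(ConformallyFlat.lean:98, chart form g = e^{2u} φ*⟪·,·⟫ near every point; Besse1987 1.159). ∀ Σ :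
Literature.Topology.FourManifolds.HomotopySphere 4, ∃ g on TΣ, g.IsRiemannian ∧
g.IsLocallyConformallyFlat. Flow-free alternative to the PIC thesis: with Kuiper1949 (cite item
fact_kuiper_v2) it gives Σ ≅ S⁴ by a covering-space argument instead of Ricci flow with surgery.
Equivalent to SPC4 modulo Kuiper (round S⁴ is conformally flat via stereographic charts); ranked 4
because no construction method for LCF metrics on an unknown Σ is in sight other than via SPC4
itself (SchoenYau1988: LCF + π₁ = 1 forces the developing map to be injective — same rigidity).
Sources: Kuiper1949; Besse1987 §1.G; SchoenYau1988. opens: `open scoped Manifold ContDiff`, `open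
ContinuousMap`; imports: Summits.SmoothPoincare4.Statement +
Literature.Topology.FourManifolds.{HomotopySpheres,GluckTwist,CorkTwist,Corks} +
Literature.Geometry.Riemannian.{IsotropicCurvature,ConformallyFlat} +
Literature.Geometry.Lorentzian.LeviCivita. Elaborated 2026-08-13 session 5 with plain `lean check`
(planner folder Sk/Sketch5.lean rc 0, 10 -/
@[route_item "route-SmoothPoincare4-PIC"]
def PicConformallyFlatV2 : Prop :=
  ∀ S : Literature.Topology.FourManifolds.HomotopySphere 4, ∃ g : Literature.Geometry.Lorentzian.PseudoRiemannianMetric (𝓡 4) ∞ (EuclideanSpace ℝ (Fin 4)) (TangentSpace (𝓡 4) : S.carrier → Type _), g.IsRiemannian ∧ g.IsLocallyConformallyFlat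

/-- item stmt-SmoothPoincare4-0380 · support · rank 0 · open · by planner
INFORMAL (needs_definition: HasPositiveIsotropicCurvature). Intended signature once the def lands:
`∀ S : Literature.Topology.FourManifolds.HomotopySphere 4, ∃ g :
Literature.Geometry.Lorentzian.PseudoRiemannianMetric (𝓡 4) ∞ (EuclideanSpace ℝ (Fin 4))
(TangentSpace (𝓡 4) : S.carrier → Type _), g.IsRiemannian ∧ HasPositiveIsotropicCurvature g`. PIC:
for every orthonormal 4-frame (e₁..e₄), K₁₃+K₁₄+K₂₃+K₂₄ − 2R₁₂₃₄ > 0 (MicallefMoore1988 Def.).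
Sources: MicallefMoore1988; Hamilton1997; ChenTangZhu2012. opens: `open scoped Manifold ContDiff`,
`open ContinuousMap`; imports: Summits.SmoothPoincare4.Statement +
Literature.Topology.FourManifolds.{HomotopySpheres,KirbyMoves,SliceRibbon,LeeRasmussen,Morse,ConnectedSum,Cobordism,GluckTwist,SurgeryGluck,CappellShaneson}
+ Literature.Geometry.Lorentzian.LeviCivita. -/
@[route_item "route-SmoothPoincare4-PIC"]
def PicThesis : Prop :=
  ∀ S : Literature.Topology.FourManifolds.HomotopySphere 4, ∃ g : Literature.Geometry.Lorentzian.PseudoRiemannianMetric (𝓡 4) ∞ (EuclideanSpace ℝ (Fin 4)) (TangentSpace (𝓡 4) : S.carrier → Type _), g.IsRiemannian ∧ g.HasPositiveIsotropicCurvature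

/-- item stmt-SmoothPoincare4-0382 · aside (kind.auto-crux: conjecture-grade) · rank 2 · open · by planner
why it might fail: auto-crux — conjecture-grade statement (docstring avows it ('conjecture')); it is open, so it may simply be false
sources: conjecture-registry
INFORMAL (needs_definition: HasPositiveIsotropicCurvature). Test family for the thesis: ∀ K :
Literature.Topology.FourManifolds.TwoKnot, ∀ X with Literature.Topology.FourManifolds.IsGluckTwist
(𝓡 4) X K, ∃ Riemannian g on X with PIC. Equivalent (given the HCTZ fact) to the Gluck twist
conjecture, but attacks it by metric construction (the twist τ is an isometry of the round S² × S¹ ⊂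
S² × D², so Σ_K = (S⁴ ∖ νK) ∪_τ S²×D² inherits PIC pieces; the crux is the neck). Sources:
Gluck1962; Hamilton1997; MicallefWang1993 (PIC is preserved under connected sum). -/
@[route_item "route-SmoothPoincare4-PIC"]
def PicGluckTwists : Prop :=
  ∀ (K : Literature.Topology.FourManifolds.TwoKnot) (X : Type) [TopologicalSpace X] [T2Space X] [SecondCountableTopology X] [ChartedSpace (EuclideanSpace ℝ (Fin 4)) X] [IsManifold (𝓡 4) ∞ X], Literature.Topology.FourManifolds.IsGluckTwist (𝓡 4) X K → ∃ g : Literature.Geometry.Lorentzian.PseudoRiemannianMetric (𝓡 4) ∞ (EuclideanSpace ℝ (Fin 4)) (TangentSpace (𝓡 4) : X → Type _), g.IsRiemannian ∧ g.HasPositiveIsotropicCurvature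

/-- item stmt-SmoothPoincare4-0475 · aside · rank 2 · open · by planner
why it might fail: Mod hamilton_pic_sphere_four it implies the Gluck twist conjecture; the gluing needs PIC across the codim-2 neck S^2 x S^1 x I, but PIC is surgery-stable only in codim >= 4 (Hoelzel Thm A; S^2 x R^2 is not PIC): no interpolation theorem exists, and one exotic Gluck twist refutes it.
sources: Gluck1962, MicallefWang1993, Hoelzel2016, Hamilton1997, Literature.Topology.FourManifolds.GluckTwistConjecture, Literature.Barriers.SmoothPoincare4.GluckTwistCP2Barrier
SUPERSEDES the informal stmt-SmoothPoincare4-0382 (def landed). ∀ K :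
Literature.Topology.FourManifolds.TwoKnot, ∀ X (T2, 2nd countable, smooth 𝓡 4) with
Literature.Topology.FourManifolds.IsGluckTwist (𝓡 4) X K, ∃ g on TX Riemannian with PIC. Test family
for the thesis; given fact_hctz_v2 it implies the Gluck twist conjecture
(Literature.Topology.FourManifolds.GluckTwistConjecture), and SPC4 ⇒ it. Line of attack by METRIC
CONSTRUCTION: Σ_K = (S⁴ ∖ νK) ∪_τ (S² × D²); the Gluck map τ is an isometry of round S² × S¹, both
pieces embed isometrically in round S⁴ (PIC, isotropic curvature ≡ 4), so the crux is a PIC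
interpolation across the neck — compare MicallefWang1993 Thm (PIC is preserved under connected sum,
a codimension-4 neck) versus the codimension-2 neck here; Hamilton1997 §1 for PIC under surgery on
incompressible S³×B¹. Kill: a Gluck twist with an obstruction to PIC would be exotic (¬SPC4).
Sources: Gluck1962; MicallefWang1993; Hamilton1997; MicallefMoore1988. opens: `open scoped Manifold
ContDiff`, `open ContinuousMap`; imports: Summits.SmoothPoincare4.Statement +
Literature.Topology.FourManifolds.{HomotopySpheres,GluckTwist,CorkTwist,Corks} +
Literature.Geometry.Riemannian. -/
@[route_item "route-SmoothPoincare4-PIC"]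
def PicGluckV2 : Prop :=
  ∀ (K : Literature.Topology.FourManifolds.TwoKnot) (X : Type) [TopologicalSpace X] [T2Space X] [SecondCountableTopology X] [ChartedSpace (EuclideanSpace ℝ (Fin 4)) X] [IsManifold (𝓡 4) ∞ X], Literature.Topology.FourManifolds.IsGluckTwist (𝓡 4) X K → ∃ g : Literature.Geometry.Lorentzian.PseudoRiemannianMetric (𝓡 4) ∞ (EuclideanSpace ℝ (Fin 4)) (TangentSpace (𝓡 4) : X → Type _), g.IsRiemannian ∧ g.HasPositiveIsotropicCurvature

/-- item stmt-SmoothPoincare4-0383 · support · rank 3 · open · by planner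
Formal over `Literature.Geometry.Lorentzian.PseudoRiemannianMetric` (IsRiemannian, scalarCurvature;
LeviCivita.lean). Necessary for the thesis (PIC ⇒ PSC). OPEN: SW/BF obstructions need b⁺ > 0,
Â-obstruction vanishes (σ = 0), minimal-hypersurface method gives nothing for π₁ = 1 in dim 4. A
homotopy 4-sphere without PSC is exotic, so refutation refutes SPC4. Sources: SchoenYau1979;
GompfStipsicz1999 §2.4; Rosenberg–Stolz surveys. -/
@[route_item "route-SmoothPoincare4-PIC"]
def PicPsc : Prop :=
  ∀ S : Literature.Topology.FourManifolds.HomotopySphere 4, ∃ g : Literature.Geometry.Lorentzian.PseudoRiemannianMetric (𝓡 4) ∞ (EuclideanSpace ℝ (Fin 4)) (TangentSpace (𝓡 4) : S.carrier → Type _), ∃ _ : g.HasLeviCivita, g.IsRiemannian ∧ ∀ x, 0 < g.scalarCurvature x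

/-- item stmt-SmoothPoincare4-0442 · aside · rank 3 · open · by planner
why it might fail: PSC on a GIVEN smooth homotopy 4-sphere is open: Gromov-Lawson-Stolz holds in dim 4 only up to homeomorphism (KumarSen2025 Obs 9); Sigma comes from S^4 by codim-2 surgeries (h-cobordism 3-handles, Gluck regluing) where PSC surgery (codim >= 3) fails; an exotic Sigma may carry a new obstruction.
sources: KumarSen2025, arXiv:2501.01113, Hoelzel2016, Literature.Topology.FourManifolds.isHCobordant_sphere_of_homotopySphere_four, Literature.Barriers.SmoothPoincare4.GaugeSumBarrierFour, Literature.Barriers.SmoothPoincare4.StableBarrierFour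
SUPERSEDES stmt-SmoothPoincare4-0383 whose signature failed to elaborate in the grounder's context
(`g.scalarCurvature` needs the Prop-class instance [g.HasLeviCivita], LeviCivita.lean:219–304). Fix
exactly as grounder-ground-A2-0 prescribed: bind `∃ _ : g.HasLeviCivita,` inside the existential.
Content unchanged: ∀ homotopy 4-sphere Σ ∃ Riemannian g on TΣ with Levi-Civita connection and scal_g
> 0 everywhere. OPEN; no known obstruction (Σ spin, σ = 0, b₂ = 0 ⇒ Lichnerowicz/SW/enlargeability
all silent; Gromov–Lawson/Stolz surgery conclusions exclude dim 4). SPC4 ⇒ this (round metric); a Σ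
without PSC would be exotic, so ¬(this) ⇒ ¬SPC4. Weaker sibling of the PIC thesis 0380 (PIC ⇒ scal >
0). Sources: Hamilton1997; MicallefMoore1988; KervaireMilnor1963. opens: `open scoped Manifold
ContDiff`, `open ContinuousMap`; imports: Summits.SmoothPoincare4.Statement +
Literature.Topology.FourManifolds.HomotopySpheres + Literature.Geometry.Lorentzian.LeviCivita.
Elaborated 2026-08-13 session 3 with plain `lean check` (folder/Sk/Sketch3.lean rc 0). -/
@[route_item "route-SmoothPoincare4-PIC"]
def PicPscV2 : Prop :=
  ∀ S : Literature.Topology.FourManifolds.HomotopySphere 4, ∃ g : Literature.Geometry.Lorentzian.PseudoRiemannianMetric (𝓡 4) ∞ (EuclideanSpace ℝ (Fin 4)) (TangentSpace (𝓡 4) : S.carrier → Type _), ∃ _ : g.HasLeviCivita, g.IsRiemannian ∧ ∀ x, 0 < g.scalarCurvature x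

/-- item stmt-SmoothPoincare4-1670 · aside · rank 3 · open · by planner
why it might fail: Equivalent to SPC4 mod CGY Thm A: on an exotic Sigma every PSC conformal class has Weyl energy >= 32 pi^2 (or Sigma has no PSC at all). No existence theory for low-energy PSC metrics: Weyl-functional minimising sequences bubble, and inf over PSC classes may exceed inf over all metrics.
sources: ChangGurskyYang2003, arXiv:math/0309287, ChangChen2021, arXiv:2109.08208, ChenZhu2014, Margerin1998
[crux] WeylEnergyPinching — INTEGRAL-PINCHING form of the thesis (informal until the definition
`weylEnergy` lands: definition request defn-weylEnergy; when typing it use the SUMMIT BINDER ∀ (M :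
Type) [TopologicalSpace M] [T2Space M] [SecondCountableTopology M] [ChartedSpace (EuclideanSpace ℝ
(Fin 4)) M] [IsManifold (𝓡 4) ∞ M], M ≃ₕ Metric.sphere (0 : EuclideanSpace ℝ (Fin 5)) 1 → …, NOT
`HomotopySphere 4`, so that no fact-bearing topology file enters the route's import cone).
Statement: every smooth homotopy 4-sphere M carries a Riemannian metric g with scal_g > 0 everywhere
and Weyl energy ∫_M |W_g|² dvol_g < 32π², |W|² = W_ijkl W^ijkl the (0,4)-norm. Intended signature: ∀
M …, M ≃ₕ S⁴ → ∃ g : Literature.Geometry.Lorentzian.PseudoRiemannianMetric (𝓡 4) ∞ (EuclideanSpace ℝ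
(Fin 4)) (TangentSpace (𝓡 4) : M → Type _), ∃ _ : g.HasLeviCivita, g.IsRiemannian ∧ (∀ x, 0 <
g.scalarCurvature x) ∧ g.weylEnergy < ENNReal.ofReal (32 * Real.pi ^ 2). WHY IT MATTERS:
ChangGurskyYang2003 Thm A (arXiv:math/0309287 p.2, read 2026-08-15): a smooth closed (M⁴, g) with
Yamabe invariant Y(M,[g]) > 0 — automatic when scal_g > 0 — and ∫|W|² dvol < 16π²χ(M) is
diffeomorphic to S⁴ or RP⁴ (proof: conformal -/
@[route_item "route-SmoothPoincare4-PIC"]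
def WeylEnergyPinching : Prop :=
  ∀ (M : Type) [TopologicalSpace M] [T2Space M] [SecondCountableTopology M] [ChartedSpace (EuclideanSpace ℝ (Fin 4)) M] [IsManifold (𝓡 4) ∞ M], M ≃ₕ Metric.sphere (0 : EuclideanSpace ℝ (Fin 5)) 1 → ∃ g : Literature.Geometry.Lorentzian.PseudoRiemannianMetric (𝓡 4) ∞ (EuclideanSpace ℝ (Fin 4)) (TangentSpace (𝓡 4) : M → Type _), ∃ _ : g.HasLeviCivita, g.IsRiemannian ∧ (∀ x, 0 < g.scalarCurvature x) ∧ g.weylEnergy < ENNReal.ofReal (32 * Real.pi ^ 2)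

/-- item stmt-SmoothPoincare4-0384 · support · rank 4 · open · by planner
INFORMAL (needs_definition: IsLocallyConformallyFlat — Weyl tensor W(g) = 0, or local conformal
charts to flat ℝ⁴). Kuiper1949: a compact simply connected locally conformally flat manifold is
conformally diffeomorphic to the round sphere; so this crux ⇒ SPC4 with a 1949 fact instead of Ricci
flow. Sources: Kuiper1949; SchoenYau1988 (conformally flat manifolds, Kleinian groups and scalar
curvature). -/
@[route_item "route-SmoothPoincare4-PIC"]
def PicConformallyFlat : Prop :=
  ∀ S : Literature.Topology.FourManifolds.HomotopySphere 4, ∃ g : Literature.Geometry.Lorentzian.PseudoRiemannianMetric (𝓡 4) ∞ (EuclideanSpace ℝ (Fin 4)) (TangentSpace (𝓡 4) : S.carrier → Type _), g.IsRiemannian ∧ g.IsLocallyConformallyFlat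

/-- item stmt-SmoothPoincare4-0374 · support · rank 5 · closed · proved by Summit.SmoothPoincare4.SmoothPoincare4.Theorems.spc4ReductionHomotopySphere_proof (prover) · by planner
Shared reduction (bookkeeping, known): SmoothPoincare4 quantifies over bare (M, T2, 2nd-countable,
charted, smooth, e : M ≃ₕ S⁴); a manifold ≃ₕ S⁴ is compact (H₄ ≠ 0 forces compactness) and simply
connected hence smoothly orientable, so it packages as an
`Literature.Topology.FourManifolds.HomotopySphere 4`. Sources: KervaireMilnor1963 §1; Literature
HomotopySpheres.lean. opens: `open scoped Manifold ContDiff`, `open ContinuousMap`; imports: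
Summits.SmoothPoincare4.Statement +
Literature.Topology.FourManifolds.{HomotopySpheres,KirbyMoves,SliceRibbon,LeeRasmussen,Morse,ConnectedSum,Cobordism,GluckTwist,SurgeryGluck,CappellShaneson}
+ Literature.Geometry.Lorentzian.LeviCivita. -/
@[route_item "route-SmoothPoincare4-PIC"]
def Spc4ReductionHomotopySphere : Prop :=
  (∀ S : Literature.Topology.FourManifolds.HomotopySphere 4, Nonempty (S.carrier ≃ₘ⟮𝓡 4, 𝓡 4⟯ Metric.sphere (0 : EuclideanSpace ℝ (Fin 5)) 1)) → SmoothPoincare4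

/-- `Spc4ReductionHomotopySphere` holds: proved by `Summit.SmoothPoincare4.SmoothPoincare4.Theorems.spc4ReductionHomotopySphere_proof`. -/
theorem Spc4ReductionHomotopySphere_holds : Spc4ReductionHomotopySphere := _root_.Summit.SmoothPoincare4.SmoothPoincare4.Theorems.spc4ReductionHomotopySphere_proof

/-- item stmt-SmoothPoincare4-0441 · support · rank 5 · open · by planner
SUPERSEDES stmt-SmoothPoincare4-0374 (grounder B/A2 + refuter A-0/A-1: TRUE bookkeeping but not
staffable as a bare implication). Now carries the two packaging facts as hypotheses: (hC) a smooth
4-manifold M ≃ₕ S⁴ is compact [Hatcher2002 Prop 3.29 + Thm 2.13; cite item filed]; (hO) such an M is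
orientable, `Literature.Topology.FourManifolds.IsOrientable (𝓡 4) M` [LeeSmoothManifolds2013 Thm
15.40 + Hatcher2002 Props 1.14/1.18; cite item filed]. Proof sketch (≈15 lines): intro hC hO h M _ _
_; unfold SmoothPoincare4 Literature.SPC4.SmoothPoincareConjectureFour
HomotopyEquiv.NonemptyDiffeomorphSphere; intro _ _ e; haveI := hC M e; obtain ⟨o⟩ := hO M e; exact h
⟨M, o, ⟨e⟩⟩ (mind the anonymous-constructor field order of
Literature.Topology.FourManifolds.HomotopySphere: carrier, [6 instances], orientation,
nonempty_homotopyEquiv; universe: carrier : Type = SmoothPoincareConjectureFour.{0} ✓). opens: `open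
scoped Manifold ContDiff`, `open ContinuousMap`; imports: Summits.SmoothPoincare4.Statement +
Literature.Topology.FourManifolds.HomotopySpheres + Literature.Geometry.Lorentzian.LeviCivita.
Elaborated 2026-08-13 session 3 with plain `lean check` (folder/Sk/Sketch3.lean rc 0). -/
@[route_item "route-SmoothPoincare4-PIC"]
def Spc4ReductionHomotopySphereV2 : Prop :=
  (∀ (M : Type) [TopologicalSpace M] [T2Space M] [SecondCountableTopology M] [ChartedSpace (EuclideanSpace ℝ (Fin 4)) M] [IsManifold (𝓡 4) ∞ M], M ≃ₕ Metric.sphere (0 : EuclideanSpace ℝ (Fin 5)) 1 → CompactSpace M) → (∀ (M : Type) [TopologicalSpace M] [T2Space M] [SecondCountableTopology M] [ChartedSpace (EuclideanSpace ℝ (Fin 4)) M] [IsManifold (𝓡 4) ∞ M], M ≃ₕ Metric.sphere (0 : EuclideanSpace ℝ (Fin 5)) 1 → Literature.Topology.FourManifolds.IsOrientable (𝓡 4) M) → (∀ S : Literature.Topology.FourManifolds.HomotopySphere 4, Nonempty (S.carrier ≃ₘ⟮𝓡 4, 𝓡 4⟯ Metric.sphere (0 : EuclideanSpace ℝ (Fin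 5)) 1)) → SmoothPoincare4

/-- item stmt-SmoothPoincare4-0477 · assembly · rank 6 · closed · proved by Literature.SPC4.lcf_assembly (refuter) · by planner
Glue for the flow-free branch: (hK) Kuiper1949 in dim 4 [cite item fact_kuiper_v2, verbatim] → (hSC)
[fact_sc, verbatim] → (crux 4 v2) → ∀ S : Literature.Topology.FourManifolds.HomotopySphere 4,
Nonempty (S.carrier ≃ₘ S⁴); then 0441 gives SmoothPoincare4. Proof identical in shape to assembly v2
(≈6 lines): intro hK hSC hX S; obtain ⟨e⟩ := S.nonempty_homotopyEquiv; haveI := hSC S.carrier e;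
exact hK S.carrier (hX S). PROVABLE NOW. Sources: Kuiper1949; Hatcher2002. opens: `open scoped
Manifold ContDiff`, `open ContinuousMap`; imports: Summits.SmoothPoincare4.Statement +
Literature.Topology.FourManifolds.{HomotopySpheres,GluckTwist,CorkTwist,Corks} +
Literature.Geometry.Riemannian.{IsotropicCurvature,ConformallyFlat} +
Literature.Geometry.Lorentzian.LeviCivita. Elaborated 2026-08-13 session 5 with plain `lean check`
(planner folder Sk/Sketch5.lean rc 0, 10 sorries, 6.3 s). -/
@[route_item "route-SmoothPoincare4-PIC"]
def Assembly3 : Prop :=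
  (∀ (M : Type) [TopologicalSpace M] [T2Space M] [SecondCountableTopology M] [ChartedSpace (EuclideanSpace ℝ (Fin 4)) M] [IsManifold (𝓡 4) ∞ M] [CompactSpace M] [SimplyConnectedSpace M], (∃ g : Literature.Geometry.Lorentzian.PseudoRiemannianMetric (𝓡 4) ∞ (EuclideanSpace ℝ (Fin 4)) (TangentSpace (𝓡 4) : M → Type _), g.IsRiemannian ∧ g.IsLocallyConformallyFlat) → Nonempty (M ≃ₘ⟮𝓡 4, 𝓡 4⟯ Metric.sphere (0 : EuclideanSpace ℝ (Fin 5)) 1)) → (∀ (M : Type) [TopologicalSpace M], M ≃ₕ Metric.sphere (0 : EuclideanSpace ℝ (Fin 5)) 1 → SimplyConnectedSpace M) → (∀ S : Literature.Topology.FourManifolds.HomotopySphere 4, ∃ g : Literature.Geometry.Lorentzian.PseudoRiemannianMetric (𝓡 4) ∞ (EuclideanSpace ℝ (Fin 4)) (TangentSpace (𝓡 4) : S.carrier → Type _), g.IsRiemannian ∧ g.IsLocallyConformallyFlat) → ∀ S : Literature.Topology.FourManifolds.HomotopySphere 4, Nonempty (S.carrier ≃ₘ⟮𝓡 4, 𝓡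 4⟯ Metric.sphere (0 : EuclideanSpace ℝ (Fin 5)) 1)

/-- `Assembly3` holds: proved by `Literature.SPC4.lcf_assembly`. -/
theorem Assembly3_holds : Assembly3 := _root_.Literature.SPC4.lcf_assembly

-- records of items no longer active in this route (dropped / restated):
-- earlier Assembly (stmt-SmoothPoincare4-0381, dropped 2026-08-16T14:43:05Z): moot by None — (∀ (M : Type) [TopologicalSpace M] [T2Space M] [SecondCountableTopology M] [ChartedSpace (EuclideanSpace ℝ (Fin 4)) M] [IsManifold (𝓡 4) ∞ M] [CompactSpace M] [SimplyConnectedSpace M], (∃ g : Literature.Geometry.Lorentzian.PseudoRiemannianMetric (𝓡 4) ∞ (EuclideanSpace ℝ (Fin 4)) (TangentSpace (𝓡 4) : M → Ty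
-- earlier Assembly2 (stmt-SmoothPoincare4-0474, dropped 2026-08-16T14:43:05Z): proved by Literature.SPC4.pic_assembly — (∀ (M : Type) [TopologicalSpace M] [T2Space M] [SecondCountableTopology M] [ChartedSpace (EuclideanSpace ℝ (Fin 4)) M] [IsManifold (𝓡 4) ∞ M] [CompactSpace M] [SimplyConnectedSpace M], (∃ g : Literature.Geometry.Lorentzian.PseudoRiemannianMetric (𝓡 4) ∞ (EuclideanSpace ℝ (Fin 4)) (

/-! D-0027 §2.1 — DECIDING THEOREM (planner-authored via `route open/edit --closes-file`; by planner-rbadge-SmoothPoincare4-PIC-d2448f85-g4-0 2026-08-15T16:52:47Z):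
its hypotheses are this route's items and its conclusion the sub-problem Statement (glue_lint), and it elaborates with this file. -/

@[closes "route-SmoothPoincare4-PIC"] theorem closes (hL : PicConformallyFlatV2) (hA : Assembly3)
    (hR : Spc4ReductionHomotopySphereV2) : _root_.SmoothPoincare4 :=
  hR (fun M _ _ _ _ _ e =>
        Literature.Topology.FourManifolds.compactSpace_of_homotopyEquiv_sphere_four_holds M e)
    (fun M _ _ _ _ _ e =>
        Literature.Topology.FourManifolds.isOrientable_of_homotopyEquiv_sphere_four_holds M e)
    (hA Literature.Geometry.Riemannian.kuiper_conformallyFlat_sphere_four_holds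
      (Literature.Topology.FourManifolds.simplyConnectedSpace_of_homotopyEquiv_sphere_four
        Literature.Topology.FourManifolds.simplyConnectedSpace_sphere_four_holds) hL)

end Summit.SmoothPoincare4.SmoothPoincare4.Theses.PIC
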